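import Literature.MathematicalPhysics.QuantumLattice.XYTorusKroneckerForm
import Literature.MathematicalPhysics.QuantumLattice.XYGriffithsBLUGroundState
import HarnessLib

/-!
# A Messager–Miracle-Solé inequality for the spin-½ quantum XY torus: reflection monotonicity
# of the in-plane two-point function

For the spin-½ XY model `H = xxzHamiltonian 1 (torusGraph d L) (-1) 0 = -Σ(SˣSˣ + SʸSʸ)` on an
even torus and a reflection `θ` through bond planes (`Torus.reflectBetweenSites j a`), we prove the
quantum analogue of the Messager–Miracle-Solé inequality (J. Stat. Phys. 17 (1977) 245, Thm. 1,
there for Ising/classical ferromagnets; Hegerfeldt, CMP 57 (1977) 259):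

* `xy_re_gibbsState_reflect_le` — for sites `x, y` of the left half and every `β ≥ 0`,
  `Re⟨Sˣ_x Sˣ_{θy}⟩_β ≤ Re⟨Sˣ_x Sˣ_y⟩_β`: moving the second spin across the plane, away from
  the first, does not increase the correlation;
* `xy_re_groundStateFunctional_reflect_le` — the same for the tracial ground-state functional
  (`β → ∞`), and `xy_re_groundState_reflect_le` — for the vector state of a non-degenerate ground
  state.

Proof (new here; Ginibre's doubling in the basis of Benassi–Lees–Ueltschi, J. Stat. Phys. 164
(2016), Lemma 8, applied to the two HALVES of the torus instead of two copies of the system).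
Along `θ` the torus system is the tensor square of the left half (`torusSplit`), and
`H = H_half ⊗ 1 + 1 ⊗ H_half - Σ_{x ∈ cross} Σ_{α<2} S^α_x ⊗ S^α_x` (`xyTorus_eq_tensorSquare`). Read
in the four-state doubled system of the left half (`dblEquiv`; `torusDbl`), this is
`H₄ = (H_half)₊ - Σ (S^α)_L (S^α)_R`, and since `(S_L S_R) = ½ S₊² - ¼` for a spin-½ component
(`(S₊)² + (S₋)² = 1`), `-βH₄ = βN - βκ` with `N = (-H_half)₊ + ½ Σ (S^α₊)²` entrywise
nonnegative in the good basis (`(Sˣ)₊, (Sʸ)₊ ≥ 0`, `(-H_half)₊ ≥ 0`: BLU Lemma 8 and the cone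
lemmas of `GinibreDoublingProofs` / `XYGriffithsBLUSchwinger`). The observable
`Sˣ_x Sˣ_y - Sˣ_x Sˣ_{θy} = (Sˣ_x)_L (Sˣ_y)₋` is entrywise nonnegative there as well, so
`Tr[(Sˣ_xSˣ_y - Sˣ_xSˣ_{θy}) e^{-βH}] = e^{-βκ} Tr[P e^{βN}] ≥ 0`.

Scope: plain frame (no sublattice rotation), zero field, nearest-neighbour XY couplings of the
torus graph, spin ½ (the basis is spin-½ specific). The anisotropic easy-plane XXZ model
(`Δ ≠ 0`) is NOT covered (the `SᶻSᶻ` cross terms are not Ginibre-positive). Consequence for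
ground-state kernels (route `LevyLogBootstrap` of `HubbardSuperconductivity`): the transverse kernel
of the XY torus ground state is reflection-monotone, hence non-increasing along each axis up to
the antipode.

## References

* A. Messager, S. Miracle-Solé, *Correlation functions and boundary conditions in the Ising
  ferromagnet*, J. Stat. Phys. 17 (1977) 245–262, Thm. 1. [MessagerMiracleSoleJSP1977]
* G. C. Hegerfeldt, CMP 57 (1977) 259–266. [Hegerfeldt1977]
* C. Benassi, B. Lees, D. Ueltschi, J. Stat. Phys. 164 (2016) 1157, §3, Lemma 8 (the basis).
  [BenassiLeesUeltschi2016]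
* T. Kennedy, E. H. Lieb, B. S. Shastry, J. Stat. Phys. 53 (1988) 1019, eq. (21) (tensor square).
  [KLS1988JSP]
-/

noncomputable section

open Matrix Finset Filter Literature.Probability.LatticeModels
open scoped Kronecker ComplexOrder Topology

namespace Literature.MathematicalPhysics.QuantumLattice

variable {d : ℕ}

/-! ### Positivity of `Tr[P e^{X}]` in Ginibre's basis -/

section GinibreTrace

variable {Λ : Type*} [Fintype Λ] [DecidableEq Λ]

/-- If `P` and `N` are entrywise nonnegative in Ginibre's basis, then `Re Tr[P e^{N}] ≥ 0`.
[cite: BenassiLeesUeltschi2016, §3 (proof of Thm. 1)] -/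
theorem re_trace_mul_exp_nonneg_of_ginibre {P N : Op Λ 4}
    (hP : ∀ i j, 0 ≤ ginibreConj Λ P i j) (hN : ∀ i j, 0 ≤ ginibreConj Λ N i j) :
    0 ≤ ((P * NormedSpace.exp N).trace).re := by
  have h : 0 ≤ (P * NormedSpace.exp N).trace := by
    rw [← trace_ginibreConj, map_mul, ginibreConj_exp]
    exact trace_nonneg_of_entrywise_nonneg (entrywise_nonneg_mul hP (entrywise_nonneg_exp hN))
  exact (Complex.nonneg_iff.mp h).1

/-- The same with a scalar shift: if `N` and `P` are entrywise nonnegative in Ginibre's basis and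
`κ` is real, then `Re Tr[P e^{N - κ·1}] ≥ 0` (`e^{N-κ} = e^{-κ} e^{N}`). [folklore] -/
theorem re_trace_mul_exp_sub_smul_one_nonneg_of_ginibre {P N : Op Λ 4}
    (hP : ∀ i j, 0 ≤ ginibreConj Λ P i j) (hN : ∀ i j, 0 ≤ ginibreConj Λ N i j) (κ : ℝ) :
    0 ≤ ((P * NormedSpace.exp (N - (κ : ℂ) • (1 : Op Λ 4))).trace).re := by
  have hcomm : Commute N (-((κ : ℂ) • (1 : Op Λ 4))) :=
    (Commute.one_right N).smul_right _ |>.neg_right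
  rw [sub_eq_add_neg, Matrix.exp_add_of_commute _ _ hcomm]
  have hexp : NormedSpace.exp (-((κ : ℂ) • (1 : Op Λ 4))) = (Real.exp (-κ) : ℂ) • (1 : Op Λ 4) := by
    rw [← neg_smul, Matrix.smul_one_eq_diagonal, Matrix.exp_diagonal]
    ext i j
    simp only [diagonal_apply, Matrix.smul_apply, Matrix.one_apply, smul_eq_mul, mul_ite, mul_one,
      mul_zero]
    split_ifs
    · rw [Pi.coe_exp, Complex.ofReal_exp, Complex.ofReal_neg, Complex.exp_eq_exp_ℂ]
    · rfl
  rw [hexp, Matrix.mul_smul, Matrix.mul_one, Matrix.mul_smul, trace_smul, smul_eq_mul,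
    Complex.re_ofReal_mul]
  exact mul_nonneg (Real.exp_pos _).le (re_trace_mul_exp_nonneg_of_ginibre hP hN)

/-- `(S^α_x)_L (S^α_x)_R = ½ ((S^α_x)₊)² - ¼` for a spin-½ component (`(S^α)² = ¼`, the two embeddings
commute). [folklore] -/
theorem dblLeft_siteSpin_mul_dblRight_siteSpin (x : Λ) (α : Fin 3) :
    dblLeft Λ (siteSpin 1 x α) * dblRight Λ (siteSpin 1 x α) =
      (1 / 2 : ℂ) • (dblPlus Λ (siteSpin 1 x α) * dblPlus Λ (siteSpin 1 x α)) -
        (1 / 4 : ℂ) • (1 : Op Λ 4) := by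
  have hsq : (siteSpin 1 x α * siteSpin 1 x α : Op Λ 2) = (1 / 4 : ℂ) • 1 := siteSpin_one_mul_self x α
  have hL : dblLeft Λ (siteSpin 1 x α) * dblLeft Λ (siteSpin 1 x α) = (1 / 4 : ℂ) • 1 := by
    rw [← map_mul, hsq, map_smul, map_one]
  have hR : dblRight Λ (siteSpin 1 x α) * dblRight Λ (siteSpin 1 x α) = (1 / 4 : ℂ) • 1 := by
    rw [← map_mul, hsq, map_smul, map_one]
  have hc := (commute_dblLeft_dblRight (Λ := Λ) (siteSpin 1 x α) (siteSpin 1 x α)).eq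
  rw [dblPlus_apply, add_mul, mul_add, mul_add, hL, hR, ← hc]
  module

/-- `(S^α_x)_L (S^α_y)₋` is entrywise nonnegative in Ginibre's basis for the in-plane direction
`α = 0` (`S_L = ½(S₊ + S₋)`). [cite: BenassiLeesUeltschi2016, Lemmas 7–8] -/
theorem entrywise_nonneg_ginibreConj_dblLeft_mul_dblMinus_spinX (x y : Λ) :
    ∀ i j, 0 ≤ ginibreConj Λ (dblLeft Λ (siteSpin 1 x 0) * dblMinus Λ (siteSpin 1 y 0)) i j := by
  have hLx : dblLeft Λ (siteSpin 1 x 0) =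
      (1 / 2 : ℂ) • (dblPlus Λ (siteSpin 1 x 0) + dblMinus Λ (siteSpin 1 x 0)) := by
    rw [dblPlus_apply, dblMinus_apply]; module
  rw [hLx, smul_mul_assoc, map_smul, map_mul, map_add]
  exact entrywise_nonneg_smul (entrywise_nonneg_mul
    (entrywise_nonneg_add (ginibreCone_siteSpin_zero x).1 (ginibreCone_siteSpin_zero x).2)
    (ginibreCone_siteSpin_zero y).2) one_half_nonneg_complex

end GinibreTrace

/-! ### The torus along `θ` as Ginibre's doubled system of the left half -/

section Bridge

variable (L : ℕ) [NeZero L] (j : Fin d) (a : ZMod L) (hL : Even L)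

/-- The identification of torus configurations with four-state configurations of the left half:
`torusSplit` followed by Ginibre's site-wise pairing `dblEquiv`. [folklore] -/
def torusDbl : TensorIndex (TorusSite d L) 2 ≃ TensorIndex (torusLeftHalf L j a) 4 :=
  (torusSplit L j a hL).trans (dblEquiv (torusLeftHalf L j a))

/-- Operators of the doubled left half act on the torus (reindexing along `torusDbl`); an algebra
isomorphism. [folklore] -/
def torusDblEmbed : Op (torusLeftHalf L j a) 4 ≃ₐ[ℂ] Op (TorusSite d L) 2 :=
  reindexAlgEquiv ℂ ℂ (torusDbl L j a hL).symm

/-- Unfolding `torusDblEmbed`. [folklore] -/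
theorem torusDblEmbed_apply (M : Op (torusLeftHalf L j a) 4) :
    torusDblEmbed L j a hL M = M.submatrix (torusDbl L j a hL) (torusDbl L j a hL) := by
  rw [torusDblEmbed, Matrix.coe_reindexAlgEquiv, reindex_apply, Equiv.symm_symm]

/-- `A ⊗ 1` on the torus is Ginibre's `a ⊗ 𝟙` of the left half, read on the torus. [folklore] -/
theorem torusLeftEmbed_eq_torusDblEmbed (A : Op (torusLeftHalf L j a) 2) :
    torusLeftEmbed L j a hL A = torusDblEmbed L j a hL (dblLeft (torusLeftHalf L j a) A) := by
  rw [torusDblEmbed_apply, dblLeft_apply, reindex_apply, torusLeftEmbed_apply, submatrix_submatrix]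
  congr 1 <;> funext σ <;> simp [torusDbl]

/-- `1 ⊗ B` on the torus is Ginibre's `𝟙 ⊗ b` of the left half, read on the torus. [folklore] -/
theorem torusRightEmbed_eq_torusDblEmbed (B : Op (torusLeftHalf L j a) 2) :
    torusRightEmbed L j a hL B = torusDblEmbed L j a hL (dblRight (torusLeftHalf L j a) B) := by
  rw [torusDblEmbed_apply, dblRight_apply, reindex_apply, torusRightEmbed_apply, submatrix_submatrix]
  congr 1 <;> funext σ <;> simp [torusDbl]

/-- **The doubled Hamiltonian** of the left half whose torus reading is the XY torus Hamiltonian: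
`H₄ = (H_half)_L + (H_half)_R - Σ_{x ∈ cross} Σ_{α<2} (S^α_x)_L (S^α_x)_R`. [cite: KLS1988JSP, eq. (21)] -/
def xyDblHamiltonian : Op (torusLeftHalf L j a) 4 :=
  dblLeft _ (xyHalfHamiltonian L j a hL 1) + dblRight _ (xyHalfHamiltonian L j a hL 1) -
    ∑ x ∈ torusCrossSites L j a, ∑ α : Fin 2,
      dblLeft _ (siteSpin 1 (torusToLeft L j a hL x) (Fin.castSucc α)) *
        dblRight _ (siteSpin 1 (torusToLeft L j a hL x) (Fin.castSucc α))

/-- The XY torus Hamiltonian is the torus reading of `xyDblHamiltonian`. [cite: KLS1988JSP, eq. (21)] -/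
theorem xyTorus_eq_torusDblEmbed :
    xxzHamiltonian 1 (torusGraph d L) (-1) 0 = torusDblEmbed L j a hL (xyDblHamiltonian L j a hL) := by
  rw [xyTorus_eq_tensorSquare L j a hL 1, xyDblHamiltonian, map_sub, map_add, map_sum,
    torusLeftEmbed_eq_torusDblEmbed, torusRightEmbed_eq_torusDblEmbed]
  congr 1
  refine sum_congr rfl fun x _ => ?_
  rw [map_sum]
  refine sum_congr rfl fun α _ => ?_
  rw [map_mul, torusLeftEmbed_eq_torusDblEmbed, torusRightEmbed_eq_torusDblEmbed]

/-- `-H₄ = N - κ·1` with `N = (-H_half)₊ + ½ Σ (S^α₊)²` and `κ = |cross|/2`. [folklore] -/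
theorem neg_xyDblHamiltonian_eq :
    -xyDblHamiltonian L j a hL =
      (dblPlus _ (-xyHalfHamiltonian L j a hL 1) +
          ∑ x ∈ torusCrossSites L j a, ∑ α : Fin 2, (1 / 2 : ℂ) •
            (dblPlus _ (siteSpin 1 (torusToLeft L j a hL x) (Fin.castSucc α)) *
              dblPlus _ (siteSpin 1 (torusToLeft L j a hL x) (Fin.castSucc α)))) -
        ((((torusCrossSites L j a).card : ℝ) / 2 : ℝ) : ℂ) • (1 : Op (torusLeftHalf L j a) 4) := by
  have hS : ∑ x ∈ torusCrossSites L j a, ∑ α : Fin 2, (1 / 4 : ℂ) • (1 : Op (torusLeftHalf L j a) 4) =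
      ((((torusCrossSites L j a).card : ℝ) / 2 : ℝ) : ℂ) • (1 : Op (torusLeftHalf L j a) 4) := by
    rw [Finset.sum_const, Finset.sum_const, Finset.card_univ, Fintype.card_fin,
      ← Nat.cast_smul_eq_nsmul ℂ, ← Nat.cast_smul_eq_nsmul ℂ, smul_smul, smul_smul]
    congr 1
    push_cast
    ring
  rw [xyDblHamiltonian, dblPlus_apply, map_neg, map_neg]
  simp only [dblLeft_siteSpin_mul_dblRight_siteSpin, Finset.sum_sub_distrib]
  rw [hS]
  abel

/-- **`N = (-H_half)₊ + ½ Σ (S^α₊)²` is entrywise nonnegative in Ginibre's basis**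
(`(SˣSˣ)₊, (SʸSʸ)₊, Sˣ₊, Sʸ₊ ≥ 0`: BLU Lemmas 7–8). [cite: BenassiLeesUeltschi2016, Lemmas 7–8] -/
theorem entrywise_nonneg_ginibreConj_xyDblPositivePart :
    ∀ i k, 0 ≤ ginibreConj (torusLeftHalf L j a)
      (dblPlus _ (-xyHalfHamiltonian L j a hL 1) +
        ∑ x ∈ torusCrossSites L j a, ∑ α : Fin 2, (1 / 2 : ℂ) •
          (dblPlus _ (siteSpin 1 (torusToLeft L j a hL x) (Fin.castSucc α)) *
            dblPlus _ (siteSpin 1 (torusToLeft L j a hL x) (Fin.castSucc α)))) i k := by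
  rw [map_add]
  refine entrywise_nonneg_add ?_ ?_
  · -- the free half Hamiltonian: a sum of `(SˣSˣ)₊ + (SʸSʸ)₊` over the left bonds
    rw [xyHalfHamiltonian, neg_neg, map_sum, map_sum]
    refine entrywise_nonneg_sum _ fun e _ => ?_
    induction e using Sym2.ind with
    | h x y =>
      rw [Sym2.lift_mk]
      change ∀ i k, 0 ≤ ginibreConj _ (dblPlus _ (xyBond 1 (torusToLeft L j a hL x)
        (torusToLeft L j a hL y))) i k
      rw [xyBond, map_add, map_add]
      exact entrywise_nonneg_add (ginibreCone_spinBond_zero _ _).1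
        (entrywise_nonneg_ginibreConj_dblPlus_spinBond_one _ _)
  · rw [map_sum]
    refine entrywise_nonneg_sum _ fun x _ => ?_
    rw [map_sum]
    refine entrywise_nonneg_sum _ fun α _ => ?_
    rw [map_smul, map_mul]
    refine entrywise_nonneg_smul (entrywise_nonneg_mul ?_ ?_) one_half_nonneg_complex <;>
    · fin_cases α
      · exact (ginibreCone_siteSpin_zero _).1
      · exact entrywise_nonneg_ginibreConj_dblPlus_siteSpin_one _

end Bridge

/-! ### Gibbs states under reindexing -/

section Transport

variable {m m' : Type*} [Fintype m] [DecidableEq m] [Fintype m'] [DecidableEq m']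

/-- Reindexing along an equivalence commutes with the Gibbs weight. [folklore] -/
theorem gibbsWeight_reindex (e : m ≃ m') (β : ℝ) (H : Matrix m m ℂ) :
    gibbsWeight β (reindex e e H) = reindex e e (gibbsWeight β H) := by
  have hf : Continuous (reindexAlgEquiv ℂ ℂ e : Matrix m m ℂ ≃ₐ[ℂ] Matrix m' m' ℂ) :=
    (reindexAlgEquiv ℂ ℂ e).toLinearEquiv.toLinearMap.continuous_of_finiteDimensional
  open scoped Matrix.Norms.Operator in
  have h := NormedSpace.map_exp (reindexAlgEquiv ℂ ℂ e) hf (-(β : ℂ) • H)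
  rw [map_smul] at h
  simp only [Matrix.coe_reindexAlgEquiv] at h
  rw [gibbsWeight, gibbsWeight]
  exact h.symm

/-- **The Gibbs state is invariant under reindexing** (relabelling the basis). [folklore] -/
theorem gibbsState_reindex (e : m ≃ m') (β : ℝ) (H O : Matrix m m ℂ) :
    gibbsState β (reindex e e H) (reindex e e O) = gibbsState β H O := by
  rw [gibbsState_apply, gibbsState_apply, partitionFn, partitionFn, gibbsWeight_reindex,
    trace_reindex_equiv, reindex_apply, reindex_apply, Matrix.submatrix_mul_equiv,
    ← reindex_apply, trace_reindex_equiv]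

end Transport

/-! ### The Messager–Miracle-Solé inequality -/

section MMS

variable (L : ℕ) [NeZero L] (j : Fin d) (a : ZMod L) (hL : Even L)

include hL

/-- **Messager–Miracle-Solé inequality for the spin-½ quantum XY torus (Gibbs states).** For the
XY Hamiltonian `H = xxzHamiltonian 1 (torusGraph d L) (-1) 0` on an even torus, a reflection `θ`
through bond planes, sites `x, y` of the left half and `β ≥ 0`:
`Re⟨Sˣ_x Sˣ_{θy}⟩_β ≤ Re⟨Sˣ_x Sˣ_y⟩_β`. Messager–Miracle-Solé, J. Stat. Phys. 17 (1977) 245,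
Thm. 1 (classical ferromagnets); quantum XY version proved here by Ginibre doubling of the two
halves in the basis of Benassi–Lees–Ueltschi (2016), Lemma 8.
[cite: MessagerMiracleSoleJSP1977, Thm. 1 (quantum XY analogue; proof via BenassiLeesUeltschi2016 Lemma 8)] -/
theorem xy_re_gibbsState_reflect_le {x y : TorusSite d L} (hx : x ∈ torusLeftHalf L j a)
    (hy : y ∈ torusLeftHalf L j a) {β : ℝ} (hβ : 0 ≤ β) :
    (gibbsState β (xxzHamiltonian 1 (torusGraph d L) (-1) 0)
        (siteSpin 1 x 0 * siteSpin 1 (Torus.reflectBetweenSites j a y) 0)).re ≤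
      (gibbsState β (xxzHamiltonian 1 (torusGraph d L) (-1) 0)
        (siteSpin 1 x 0 * siteSpin 1 y 0)).re := by
  set Λh := torusLeftHalf L j a
  set H := xxzHamiltonian 1 (torusGraph d L) (-1) 0 with hHdef
  set H₄ := xyDblHamiltonian L j a hL with hH₄
  set X : Op Λh 2 := siteSpin 1 (torusToLeft L j a hL x) 0 with hX
  set Y : Op Λh 2 := siteSpin 1 (torusToLeft L j a hL y) 0 with hY
  set P : Op Λh 4 := dblLeft Λh X * dblMinus Λh Y with hP
  have hθy : Torus.reflectBetweenSites j a y ∉ torusLeftHalf L j a := fun h =>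
    (reflectBetweenSites_mem_torusLeftHalf_iff L j a hL y).1 h hy
  -- the observable `Sˣ_x Sˣ_y - Sˣ_x Sˣ_{θy}` is the torus reading of `P`
  have hobs : siteSpin 1 x 0 * siteSpin 1 y 0 - siteSpin 1 x 0 * siteSpin 1 (Torus.reflectBetweenSites j a y) 0 =
      torusDblEmbed L j a hL P := by
    rw [siteSpin_eq_torusLeftEmbed (hL := hL) 1 hx, siteSpin_eq_torusLeftEmbed (hL := hL) 1 hy,
      siteSpin_eq_torusRightEmbed (hL := hL) 1 hθy, torusToLeft_reflectBetweenSites, ← hX, ← hY,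
      torusLeftEmbed_eq_torusDblEmbed L j a hL, torusLeftEmbed_eq_torusDblEmbed L j a hL,
      torusRightEmbed_eq_torusDblEmbed L j a hL, ← mul_sub, ← map_sub, ← map_mul, hP,
      dblMinus_apply]
  -- transport the Gibbs expectation to the doubled left half
  have hgibbs : gibbsState β H (torusDblEmbed L j a hL P) = gibbsState β H₄ P := by
    rw [hHdef, xyTorus_eq_torusDblEmbed L j a hL, torusDblEmbed, Matrix.coe_reindexAlgEquiv,
      gibbsState_reindex]
  -- positivity of `Tr[P e^{-βH₄}]`
  have hpos : 0 ≤ ((P * gibbsWeight β H₄).trace).re := by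
    have hN := entrywise_nonneg_ginibreConj_xyDblPositivePart L j a hL
    have hβN : ∀ i k, 0 ≤ ginibreConj Λh ((β : ℂ) • (dblPlus _ (-xyHalfHamiltonian L j a hL 1) +
        ∑ x ∈ torusCrossSites L j a, ∑ α : Fin 2, (1 / 2 : ℂ) •
          (dblPlus _ (siteSpin 1 (torusToLeft L j a hL x) (Fin.castSucc α)) *
            dblPlus _ (siteSpin 1 (torusToLeft L j a hL x) (Fin.castSucc α))))) i k := by
      rw [map_smul]
      exact entrywise_nonneg_smul hN (Complex.zero_le_real.mpr hβ)
    have hW : gibbsWeight β H₄ = NormedSpace.exp ((β : ℂ) • (dblPlus _ (-xyHalfHamiltonian L j a hL 1) +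
        ∑ x ∈ torusCrossSites L j a, ∑ α : Fin 2, (1 / 2 : ℂ) •
          (dblPlus _ (siteSpin 1 (torusToLeft L j a hL x) (Fin.castSucc α)) *
            dblPlus _ (siteSpin 1 (torusToLeft L j a hL x) (Fin.castSucc α)))) -
        ((β * (((torusCrossSites L j a).card : ℝ) / 2) : ℝ) : ℂ) • (1 : Op Λh 4)) := by
      rw [gibbsWeight, neg_smul, ← smul_neg, hH₄, neg_xyDblHamiltonian_eq, smul_sub, smul_smul]
      congr 2
      push_cast
      ring
    rw [hW]
    exact re_trace_mul_exp_sub_smul_one_nonneg_of_ginibre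
      (entrywise_nonneg_ginibreConj_dblLeft_mul_dblMinus_spinX _ _) hβN _
  -- assemble: the difference of the two expectations is `Z⁻¹ Tr[W P]` with `Z > 0`
  have hHerm : H.IsHermitian := xxzHamiltonian_isHermitian 1 _ (-1) 0
  haveI : Nonempty (TensorIndex (TorusSite d L) 2) := ⟨fun _ => 0⟩
  have hZ : 0 < partitionFn β H := partitionFn_pos β hHerm
  obtain ⟨Z, hZpos, hZeq⟩ : ∃ Z : ℝ, 0 < Z ∧ partitionFn β H = Z := by
    obtain ⟨hre, him⟩ := Complex.pos_iff.mp hZ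
    exact ⟨(partitionFn β H).re, hre, Complex.ext rfl him.symm⟩
  have hZ4 : partitionFn β H₄ = partitionFn β H := by
    rw [hHdef, xyTorus_eq_torusDblEmbed L j a hL, torusDblEmbed, Matrix.coe_reindexAlgEquiv,
      partitionFn, partitionFn, gibbsWeight_reindex, trace_reindex_equiv]
  rw [← sub_nonneg, ← Complex.sub_re, ← map_sub, hobs, hgibbs, gibbsState_apply, hZ4, hZeq,
    trace_mul_comm, ← Complex.ofReal_inv, Complex.re_ofReal_mul]
  exact mul_nonneg (inv_nonneg.mpr hZpos.le) hpos

/-- **Messager–Miracle-Solé inequality for the XY torus, ground states (tracial form).** The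
zero-temperature limit: for the tracial ground-state functional `ω₀` of
`H = xxzHamiltonian 1 (torusGraph d L) (-1) 0` and `x, y` in the left half,
`Re ω₀(Sˣ_x Sˣ_{θy}) ≤ Re ω₀(Sˣ_x Sˣ_y)`.
[cite: MessagerMiracleSoleJSP1977, Thm. 1 (quantum XY analogue, β → ∞)] -/
theorem xy_re_groundStateFunctional_reflect_le {x y : TorusSite d L}
    (hx : x ∈ torusLeftHalf L j a) (hy : y ∈ torusLeftHalf L j a) :
    ((xxzHamiltonian 1 (torusGraph d L) (-1) 0).groundStateFunctional
        (siteSpin 1 x 0 * siteSpin 1 (Torus.reflectBetweenSites j a y) 0)).re ≤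
      ((xxzHamiltonian 1 (torusGraph d L) (-1) 0).groundStateFunctional
        (siteSpin 1 x 0 * siteSpin 1 y 0)).re := by
  set H := xxzHamiltonian 1 (torusGraph d L) (-1) 0 with hHdef
  have hH : H.IsHermitian := xxzHamiltonian_isHermitian 1 _ (-1) 0
  haveI : Nonempty (TensorIndex (TorusSite d L) 2) := ⟨fun _ => 0⟩
  have hT : ∀ A : Op (TorusSite d L) 2, Tendsto (fun β : ℝ => (gibbsState β H A).re) atTop
      (𝓝 (H.groundStateFunctional A).re) := fun A =>
    (Complex.continuous_re.tendsto _).comp (tendsto_gibbsState_atTop_holds hH A)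
  refine le_of_tendsto_of_tendsto (hT _) (hT _) (Filter.eventually_atTop.2 ⟨0, fun β hβ => ?_⟩)
  exact xy_re_gibbsState_reflect_le L j a hL hx hy hβ

/-- **Messager–Miracle-Solé inequality for the XY torus, non-degenerate ground state (vector
form).** If the ground state of `H = xxzHamiltonian 1 (torusGraph d L) (-1) 0` is unique and
`ψ` is a normalised ground vector, then for `x, y` in the left half
`Re⟨ψ, Sˣ_x Sˣ_{θy} ψ⟩ ≤ Re⟨ψ, Sˣ_x Sˣ_y ψ⟩`: the in-plane two-point function of the ground state
is REFLECTION-MONOTONE (non-increasing as the second site crosses bond planes away from the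
first), hence non-increasing along each axis up to the antipode.
[cite: MessagerMiracleSoleJSP1977, Thm. 1 (quantum XY analogue, β → ∞)] -/
theorem xy_re_groundState_reflect_le
    (hU : (xxzHamiltonian 1 (torusGraph d L) (-1) 0).HasUniqueGroundState)
    {ψ : TensorIndex (TorusSite d L) 2 → ℂ}
    (hψ : ψ ∈ (xxzHamiltonian 1 (torusGraph d L) (-1) 0).groundSpace) (hnorm : star ψ ⬝ᵥ ψ = 1)
    {x y : TorusSite d L} (hx : x ∈ torusLeftHalf L j a) (hy : y ∈ torusLeftHalf L j a) :
    (star ψ ⬝ᵥ (siteSpin 1 x 0 * siteSpin 1 (Torus.reflectBetweenSites j a y) 0) *ᵥ ψ).re ≤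
      (star ψ ⬝ᵥ (siteSpin 1 x 0 * siteSpin 1 y 0) *ᵥ ψ).re := by
  have hψ0 : ψ ≠ 0 := by
    rintro rfl
    simp at hnorm
  have h := xy_re_groundStateFunctional_reflect_le L j a hL hx hy
  rwa [groundStateFunctional_eq_of_hasUniqueGroundState hU hψ hψ0,
    groundStateFunctional_eq_of_hasUniqueGroundState hU hψ hψ0, hnorm, div_one, div_one] at h

end MMS

end Literature.MathematicalPhysics.QuantumLattice

end
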